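import Mathlib.Tactic.Linarith
import Summits.CriticalPhenomena.PercolationContinuityZ3.Theorems.PercNearOneGluingNoHeavyLowerTailSahiCTCNcSplitNested
import HarnessLib

/-!
# `NoHeavyLowerTail` (crux stmt-CriticalPhenomena-4575), P3 lane: the level-split form `R_c` is nonnegative as soon as ONE of the two
# complexes has no face above level `c` — `t_X = ∅ ⇒ R_c(K_X,K_Z) = D_c·(Π·GF(h_X ∩ K_Z) − h_X·K_Z) ∈ ℕ[r]` (a Harris block)

Support file (seat `prim-l12-p3`, gen 23; `--supports stmt-CriticalPhenomena-4575`).  Memo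
`run/shared/lean/prim/prim-l12/FROM-prim-l12-p3-g23-LEVEL-SPLIT.md` §1.3.  Companions: `…SahiCTCNcSplit` (`R_c = D_c·(Π·h_Y − K_X·K_Z) +
Π·t_X·t_Z`, and `coeff_RcForm_nonneg_of_facesGT_empty` for the case `t_X = t_Z = ∅`), `…SahiCTCNcSplitNested`.

If `K_X` has no face of size `> c` then `K_X = h_X`, the common small faces are `h_X ∩ K_Z`, and the second summand of `R_c` vanishes, so
`R_c(K_X,K_Z) = D_c·(Π·GF(h_X ∩ K_Z) − GF(h_X)·GF(K_Z))` (`RcForm_eq_of_facesGT_empty_left`) — `D_c` times the Harris block of the down-sets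
`h_X` and `K_Z` (`…SahiCTCHarrisBlock.coeff_harris_sub_nonneg`).  Hence `R_c ∈ ℕ[r]` whenever `t_X = ∅` or (by `RcForm` symmetry) `t_Z = ∅`
(`coeff_RcForm_nonneg_of_facesGT_empty_left/right`).  In the complement-dual language of the slot "at least two of `k` open" (`c = k − 2`,
memo §3) this says: `R' ≥ 0` as soon as one of the two up-sets of open sets has no singleton member.  Nothing is asserted about the crux.
-/

namespace Summit.CriticalPhenomena.PercolationContinuityZ3.Theorems.SahiCTCForms

open Finset MvPolynomial SahiCTCGenFun

variable {α : Type*} [DecidableEq α] [Fintype α]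

/-- `h_Y = h_X ∩ K_Z`. [this work] -/
theorem commonLE_eq_facesLE_inter (c : ℕ) (KX KZ : Finset (Finset α)) : commonLE c KX KZ = facesLE c KX ∩ KZ := by
  ext S; simp only [commonLE, facesLE, mem_filter, mem_inter, mem_powerset, subset_univ, true_and]; tauto

/-- **`R_c` when `K_X` has no face above level `c`**: `R_c = D_c·(Π·GF(h_X ∩ K_Z) − h_X·K_Z)`. [this work] -/
theorem RcForm_eq_of_facesGT_empty_left (c : ℕ) {KX KZ : Finset (Finset α)} (hX : facesGT c KX = ∅) :
    RcForm c KX KZ = DdC c * (PiP * gf (facesLE c KX ∩ KZ) - gf (facesLE c KX) * gf KZ) := by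
  have hK : gf KX = gf (facesLE c KX) := by
    rw [gf_eq_facesLE_add_facesGT c KX, hX]; unfold gf; simp
  unfold RcForm
  rw [commonLE_eq_facesLE_inter, hK, hX]
  unfold gf; simp

/-- `R_c` is symmetric under `X ↔ Z`. [this work] -/
theorem RcForm_comm' (c : ℕ) (KX KZ : Finset (Finset α)) : RcForm c KX KZ = RcForm c KZ KX := by
  unfold RcForm; rw [commonLE_comm c KZ KX]; ring

/-- **`R_c(K_X,K_Z) ∈ ℕ[r]` whenever `K_X` has no face of size `> c`** (`K_Z` any down-set). [this work] -/
theorem coeff_RcForm_nonneg_of_facesGT_empty_left (c : ℕ) {KX KZ : Finset (Finset α)} (hKX : IsLowerSet (KX : Set (Finset α)))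
    (hKZ : IsLowerSet (KZ : Set (Finset α))) (hX : facesGT c KX = ∅) : ∀ n, 0 ≤ (RcForm c KX KZ).coeff n := by
  obtain ⟨-, -, -, hDd⟩ := coeff_PiP_ee_nonneg (α := α) c
  intro n
  rw [RcForm_eq_of_facesGT_empty_left c hX]
  exact cw_mul hDd (coeff_harris_sub_nonneg (isLowerSet_facesLE c hKX) hKZ) n

/-- **`R_c(K_X,K_Z) ∈ ℕ[r]` whenever `K_Z` has no face of size `> c`** (`K_X` any down-set). [this work] -/
theorem coeff_RcForm_nonneg_of_facesGT_empty_right (c : ℕ) {KX KZ : Finset (Finset α)} (hKX : IsLowerSet (KX : Set (Finset α)))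
    (hKZ : IsLowerSet (KZ : Set (Finset α))) (hZ : facesGT c KZ = ∅) : ∀ n, 0 ≤ (RcForm c KX KZ).coeff n := by
  intro n; rw [RcForm_comm']; exact coeff_RcForm_nonneg_of_facesGT_empty_left c hKZ hKX hZ n

/-- Consequently, if `K_X` has no face above level `c` and its `c`-skeleton is nested in that of `K_Z` (i.e. `K_X ⊆ K_Z`) OR contains it,
`Ñ_c(K_X,K_Z) ∈ ℕ[r]`; the containing case is not covered by `…NcSplitNestedR`: **`h_Z ⊆ K_X = h_X` ⇒ `Ñ_c ∈ ℕ[r]`**. [this work] -/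
theorem coeff_Ngen_nonneg_of_facesGT_empty_of_skeleton_ge (c : ℕ) {KX KZ : Finset (Finset α)} (hKX : IsLowerSet (KX : Set (Finset α)))
    (hKZ : IsLowerSet (KZ : Set (Finset α))) (hX : facesGT c KX = ∅) (hsub : facesLE c KZ ⊆ facesLE c KX) :
    ∀ n, 0 ≤ (Ngen c KX KZ).coeff n :=
  coeff_Ngen_nonneg_of_split (coeff_TcForm_nonneg_of_nested' c hKZ hsub) (coeff_RcForm_nonneg_of_facesGT_empty_left c hKX hKZ hX)

end Summit.CriticalPhenomena.PercolationContinuityZ3.Theorems.SahiCTCForms
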